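import Summits.ValiantsHypothesis.ValiantsHypothesis.Theses.LiftNullstellensatz
import Summits.ValiantsHypothesis.ValiantsHypothesis.Theorems.HubHub

/-!
# LiftNullstellensatz — `Assembly` (item stmt-ValiantsHypothesis-5926)

The rank-1 assembly item of route `LiftNullstellensatz`:
`LiftAvoidanceQP → PerLiftQPOfVP → ValiantsHypothesis`.

Pure bookkeeping over PROVED tree facts (no named-fact hypotheses, so the theorem is
unconditional): were `VP ℂ = VNP ℂ`, Valiant's theorem `perFamily ℂ ∈ VNP ℂ`
(`Literature.Computability.AlgebraicComplexity.perFamily_mem_VNP_holds`) and the renaming bridge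
`perFamily ℂ ∈ VP ℂ ↔ IsVPFamily (fun n => perPoly (Fin n) ℂ)`
(`Literature.Computability.AlgebraicComplexity.mem_VP_ofFintype_iff_holds`) would make the
permanent family a `VP` family; `PerLiftQPOfVP` then gives an exponent `c` and, for EVERY `n`, a
word lift `Ψ` of `per_n` all of whose sequential flattenings have rank `≤ 2^((log₂ n + c)^c)`,
while `LiftAvoidanceQP` at this `c` gives a threshold `n₀` beyond which every lift of `per_n` has
SOME sequential flattening of rank `> 2^((log₂ n + c)^c)` — contradiction at `n = n₀`.
The step "`per` not a `VP` family ⇒ `VP ℂ ≠ VNP ℂ`" is the landed hub lemma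
`Summit.ValiantsHypothesis.Hub.valiantsHypothesis_of_not_isVPFamily_per` (Theorems/HubHub.lean).
The proof is deliberately self-contained (it does not invoke the route file's deciding theorem
`closes`, whose text the planner may re-render).
-/

-- `Summit.ValiantsHypothesis.ValiantsHypothesis.…` is the tree's mandated single-conjunct layout
-- (Sub = Summit), so the duplicated namespace component is intended.
set_option linter.dupNamespace false

namespace Summit.ValiantsHypothesis.ValiantsHypothesis.Theorems.LiftNullstellensatzAssembly

open Literature.Computability.AlgebraicComplexity

/-- **Assembly** (item stmt-ValiantsHypothesis-5926 of route LiftNullstellensatz):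
`LiftAvoidanceQP → PerLiftQPOfVP → ValiantsHypothesis`.
Bookkeeping: if `VP ℂ = VNP ℂ` then `per ∈ VNP` (Valiant 1979, proved in tree) and the renaming
bridge make `(per_n)_n` a `VP` family; `PerLiftQPOfVP` yields `c` and lifts of `per_n` of TT-rank
`≤ 2^((log₂ n + c)^c)` for all `n`; `LiftAvoidanceQP` at `c` yields `n₀` and, for that lift at
`n = n₀`, a cut of strictly larger rank — absurd. [folklore] -/
theorem assembly_proof :
    Summit.ValiantsHypothesis.ValiantsHypothesis.Theses.LiftNullstellensatz.Assembly := by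
  unfold Summit.ValiantsHypothesis.ValiantsHypothesis.Theses.LiftNullstellensatz.Assembly
  intro hLift hPer
  refine Summit.ValiantsHypothesis.Hub.valiantsHypothesis_of_not_isVPFamily_per ?_
    (mem_VP_ofFintype_iff_holds _) (perFamily_mem_VNP_holds ℂ)
  intro hfam
  -- VP ⇒ lifts of quasi-polynomial TT-rank at some exponent `c`, for every `n` ...
  obtain ⟨c, hc⟩ := hPer hfam
  -- ... contradicting lift avoidance at this `c`, at the threshold `n₀` itself.
  obtain ⟨n₀, hn₀⟩ := hLift c
  obtain ⟨Ψ, hΨ, hrank⟩ := hc n₀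
  obtain ⟨k, l, h, hlt⟩ := hn₀ n₀ le_rfl Ψ hΨ
  exact absurd hlt (not_lt.mpr (hrank k l h))

end Summit.ValiantsHypothesis.ValiantsHypothesis.Theorems.LiftNullstellensatzAssembly
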